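import Summits.HodgeConjecture.HodgeConjecture.Theorems.LinearSystemTorelliLocalTubeSpanUnimodularTransitivityLemmas
import Mathlib.RingTheory.Coprime.Lemmas
import Mathlib.Tactic.Module

/-!
# Route LinearSystemTorelli — crux `LocalTubeSpan` (stmt-HodgeConjecture-2490): all squares are monodromy — stripping the plane part

Helper file (`--supports stmt-HodgeConjecture-2490`, line `Sketch` of the crux chain, cycle 9,
continuation lead c7; the lead's stub `stub_squares_strip`, worker S2).

Cycle 9 proves that every square `T_a² : v ↦ v - 2⟨v, a⟩a` (`a ∈ ℤΔ`) lies in the monodromy group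
`Γ_Δ = transvectionGroup B Δ` of a skew vanishing lattice.  Write `P x` for "some `g ∈ Γ_Δ` acts as
`T_x²`".  The SQUARE STEP (stub `stub_squares_step`, granted here as the hypothesis `hstep`) says
`P x ↔ P (x + δ)` for `δ ∈ Δ` orthogonal to the lattice vector `x`; the PRIMITIVE VECTORS of the
unimodular plane of `u, w` (stub `stub_primitive_mem`, granted as `hprim`) say `αu + βw ∈ Δ` for
coprime `α, β`.

THIS FILE (`localTubeSpan_squares_strip`): for a lattice vector `m ⟂ u, w` and ALL integers `α, β`,
`P m ↔ P (αu + βw + m)`.  Proof: `α = β = 0` is trivial; otherwise `α = d α₀`, `β = d β₀` with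
`d = gcd(α, β) > 0` and `α₀, β₀` coprime, so `p₀ := α₀ u + β₀ w ∈ Δ`; since `B` is alternating and
`m ⟂ u, w`, `p₀` is orthogonal to every `x_j := j p₀ + m` (`j : ℕ`, a lattice vector), and the square
step gives `P x_j ↔ P x_{j+1}`; induction on `j` up to `j = d` (`localTubeSpan_squares_iterate`).

Mathlib only (`Int.exists_gcd_one'`, `Int.isCoprime_iff_gcd_eq_one`, `module`); no named facts;
no `sorry`.
-/

-- `Summit.HodgeConjecture.HodgeConjecture.Theorems` is the mandated namespace (single-conjunct summit:
-- Sub = Summit), which `linter.dupNamespace` flags on every declaration; the lakefile turns the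
-- linter off tree-wide (weak option), restated here so stand-alone elaboration is warning-free too.
set_option linter.dupNamespace false

noncomputable section

open Literature.AlgebraicGeometry.HodgeTheory

namespace Summit.HodgeConjecture.HodgeConjecture.Theorems

variable {V : Type} [AddCommGroup V] [Module ℚ V]

/-- ITERATED SQUARE STEP.  If `p₀ ∈ Δ` is orthogonal to the lattice vector `m` (and `B` is
alternating, so `p₀ ⟂ j p₀ + m` for every `j`), then `T_m²` is realised in `Γ_Δ` iff `T_{j p₀ + m}²`
is, for every `j : ℕ` — the square step `P x ↔ P (x + p₀)` (hypothesis `hstep`) iterated `j` times.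
[folklore] -/
theorem localTubeSpan_squares_iterate (B : LinearMap.BilinForm ℚ V) (hB : B.IsAlt) (Δ : Set V)
    (hstep : ∀ δ ∈ Δ, ∀ x ∈ Submodule.span ℤ Δ, B δ x = 0 →
      ((∃ g ∈ transvectionGroup B Δ, ∀ v : V,
          ((g : (V →ₗ[ℚ] V)ˣ) : V →ₗ[ℚ] V) v = v - (2 : ℚ) • (B v x • x)) ↔
       (∃ g ∈ transvectionGroup B Δ, ∀ v : V,
          ((g : (V →ₗ[ℚ] V)ˣ) : V →ₗ[ℚ] V) v = v - (2 : ℚ) • (B v (x + δ) • (x + δ)))))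
    {p₀ m : V} (hp₀ : p₀ ∈ Δ) (hm : m ∈ Submodule.span ℤ Δ) (hp₀m : B p₀ m = 0) (j : ℕ) :
    (∃ g ∈ transvectionGroup B Δ, ∀ v : V,
        ((g : (V →ₗ[ℚ] V)ˣ) : V →ₗ[ℚ] V) v = v - (2 : ℚ) • (B v m • m)) ↔
    (∃ g ∈ transvectionGroup B Δ, ∀ v : V,
        ((g : (V →ₗ[ℚ] V)ˣ) : V →ₗ[ℚ] V) v =
          v - (2 : ℚ) • (B v ((j : ℚ) • p₀ + m) • ((j : ℚ) • p₀ + m))) := by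
  induction j with
  | zero => rw [Nat.cast_zero, zero_smul, zero_add]
  | succ j ih =>
    -- the lattice vector `x_j := j p₀ + m` is orthogonal to `p₀`
    have hxj : (j : ℚ) • p₀ + m ∈ Submodule.span ℤ Δ := by
      refine Submodule.add_mem _ ?_ hm
      have h := localTubeSpan_intCast_smul_mem Δ (Submodule.subset_span hp₀) (j : ℤ)
      rwa [Int.cast_natCast] at h
    have horth : B p₀ ((j : ℚ) • p₀ + m) = 0 := by
      rw [map_add, map_smul, hB.self_eq_zero, hp₀m, smul_zero, zero_add]
    have hx : (j : ℚ) • p₀ + m + p₀ = ((j + 1 : ℕ) : ℚ) • p₀ + m := by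
      push_cast
      module
    rw [← hx]
    exact ih.trans (hstep p₀ hp₀ _ hxj horth)

/-- **STRIP THE PLANE PART** (the lead's stub `stub_squares_strip`, cycle 9, minimal hypotheses).
For an alternating form `B`, a subset `Δ`, two vectors `u, w` (in the application a unimodular pair of
a skew vanishing lattice `Δ`), a lattice vector `m ⟂ u, w` and ANY integers `α, β`: some element of
`Γ_Δ` acts as `T_m²` iff some element acts as `T_{αu + βw + m}²` — granted the square step (`hstep`,
stub `stub_squares_step`) and that the primitive vectors `αu + βw` (`α, β` coprime) of the plane lie
in `Δ` (`hprim`, stub `stub_primitive_mem`).  Neither `IsSkewVanishingLattice B Δ` nor `u, w ∈ Δ`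
nor `B u w = 1` is used beyond these two granted consequences.  (`αu + βw = d p₀` with
`d = gcd(α, β)` and `p₀ = α₀ u + β₀ w ∈ Δ` primitive, `p₀ ⟂ j p₀ + m`: `d` square steps,
`localTubeSpan_squares_iterate`.) [folklore] -/
theorem localTubeSpan_squares_strip (B : LinearMap.BilinForm ℚ V) (hB : B.IsAlt) (Δ : Set V)
    {u w : V}
    (hstep : ∀ δ ∈ Δ, ∀ x ∈ Submodule.span ℤ Δ, B δ x = 0 →
      ((∃ g ∈ transvectionGroup B Δ, ∀ v : V,
          ((g : (V →ₗ[ℚ] V)ˣ) : V →ₗ[ℚ] V) v = v - (2 : ℚ) • (B v x • x)) ↔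
       (∃ g ∈ transvectionGroup B Δ, ∀ v : V,
          ((g : (V →ₗ[ℚ] V)ˣ) : V →ₗ[ℚ] V) v = v - (2 : ℚ) • (B v (x + δ) • (x + δ)))))
    (hprim : ∀ α β : ℤ, IsCoprime α β → (α : ℚ) • u + (β : ℚ) • w ∈ Δ)
    {m : V} (hm : m ∈ Submodule.span ℤ Δ) (hum : B u m = 0) (hwm : B w m = 0) (α β : ℤ) :
    (∃ g ∈ transvectionGroup B Δ, ∀ v : V,
        ((g : (V →ₗ[ℚ] V)ˣ) : V →ₗ[ℚ] V) v = v - (2 : ℚ) • (B v m • m)) ↔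
    (∃ g ∈ transvectionGroup B Δ, ∀ v : V,
        ((g : (V →ₗ[ℚ] V)ˣ) : V →ₗ[ℚ] V) v =
          v - (2 : ℚ) • (B v ((α : ℚ) • u + (β : ℚ) • w + m) • ((α : ℚ) • u + (β : ℚ) • w + m))) := by
  rcases Nat.eq_zero_or_pos (Int.gcd α β) with h0 | hpos
  · -- `α = β = 0`: both sides are `P m`
    obtain ⟨rfl, rfl⟩ := Int.gcd_eq_zero_iff.1 h0
    simp only [Int.cast_zero, zero_smul, zero_add]
  · -- `α = d α₀`, `β = d β₀`, `p₀ := α₀ u + β₀ w ∈ Δ` primitive and orthogonal to `m`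
    obtain ⟨d, α₀, β₀, -, hcop, rfl, rfl⟩ := Int.exists_gcd_one' hpos
    have hp₀ : (α₀ : ℚ) • u + (β₀ : ℚ) • w ∈ Δ :=
      hprim α₀ β₀ (Int.isCoprime_iff_gcd_eq_one.2 hcop)
    have hp₀m : B ((α₀ : ℚ) • u + (β₀ : ℚ) • w) m = 0 := by
      rw [map_add, map_smul, map_smul, LinearMap.add_apply, LinearMap.smul_apply,
        LinearMap.smul_apply, hum, hwm, smul_zero, smul_zero, add_zero]
    have key := localTubeSpan_squares_iterate B hB Δ hstep hp₀ hm hp₀m d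
    rwa [show ((d : ℕ) : ℚ) • ((α₀ : ℚ) • u + (β₀ : ℚ) • w) + m =
        ((α₀ * (d : ℤ) : ℤ) : ℚ) • u + ((β₀ * (d : ℤ) : ℤ) : ℚ) • w + m by
      push_cast; module] at key

end Summit.HodgeConjecture.HodgeConjecture.Theorems

end
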